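import Literature.Barriers.CriticalPhenomena.RigorousRGSmallParameterDiscreteTaylorBase
import Mathlib.Data.Fin.Tuple.Basic
import Mathlib.Data.Nat.Choose.Vandermonde
import HarnessLib

/-!
# `RigorousRGSmallParameter` (Slade, Theorem 1.4.1): the `k`-variable discrete Taylor (Newton) expansion
# of total degree `s` with remainder `≤ M·C(|u|₁, s+1)` — [BS-rg-loc] Lemma 3.3.3 on `ℕ^k`

Companion ("proof architecture") file of
`Literature/Barriers/CriticalPhenomena/RigorousRGSmallParameter.lean` (Loc norm-estimates layer,
towards [BS-rg-loc] Proposition 1.4.6 via Lemma (lem:phij)). [BS-rg-loc] Lemma 3.3.3: "for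
`|β|₁ = t ≤ s` … `|∇^β(g - Tay_a g)_z| ≤ M_g C(|z-a⃗|₁, s-t+1)` … It remains to prove (e:Tayrem)
[`|g_z - f_z| ≤ M_g C(|z|₁, s+1)`]. The proof is by induction on `p` (with `s` held fixed) … [case
`p = 1` = `…DiscreteTaylor`] … To advance the induction … apply the case `p-1` to `g` with the
coordinate `z_p` regarded as a parameter. This gives `g_z = Σ_{|β|₁≤s} C(y,β)D^βg_{(0,z_p)} + Ẽ`
(e:IH) … `|Ẽ| ≤ M_g C(|y|₁, s+1)`", combined with the one-variable expansions of the coefficients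
and Vandermonde's identity ("the proof … does not depend on the grouping of these components of `z`
into `ℤ^d`"). This file PROVES the statement for functions `G : ℤ^k → ℝ` at the origin (the general
base point reduces to it by translation, `…DiscreteTaylorBase`): with partial differences `Δ_i`,
their lists `ldiff` (a `napply`-like composition), and the recursively defined Newton polynomial
`taylorN` of total degree `s`, if `|Δ^L G| ≤ M` on the box `[0,B]` for all coordinate lists `L` of
length `s+1`, then **`|G(u) - taylorN_s G(u)| ≤ M·C(|u|₁, s+1)`** for `u ≤ B`. All PROVED, 0 sorry:

* `pdiff`, `ldiff` (+`_nil/_cons/_append/_replicate`), `pdiff_last_snoc`, `iter_pdiff_last_snoc`,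
  `pdiff_castSucc_snoc`, **`ldiff_map_castSucc_snoc`** (freezing the last coordinate);
* **`taylorN`**, `vandermonde_split`, **`abs_sub_taylorN_le`**.

Sources: D. C. Brydges, G. Slade, *A renormalisation group method. II. Approximation by local
polynomials*, J. Stat. Phys. 159 (2015) 461–491, arXiv:1403.7253, Lemma 3.3.3 (displays
(e:Tayrem2), (e:Tayrem), (e:IH) and the induction step), TeX-source numbering.

## References

* [BrydgesSlade2015RGII] D. C. Brydges, G. Slade, *A renormalisation group method. II.
  Approximation by local polynomials*, J. Stat. Phys. **159** (2015) 461–491, arXiv:1403.7253.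
-/

noncomputable section

namespace Literature.Barriers.CriticalPhenomena

namespace LongRangePhi4

namespace Bump

open Finset

/-! ### Partial differences and their lists -/

/-- The forward difference in coordinate `i`. [folklore] -/
def pdiff {k : ℕ} (i : Fin k) (G : (Fin k → ℤ) → ℝ) : (Fin k → ℤ) → ℝ :=
  fun u => G (Function.update u i (u i + 1)) - G u

/-- Iterated partial differences along a list of coordinates (outermost first). [folklore] -/
def ldiff {k : ℕ} (L : List (Fin k)) (G : (Fin k → ℤ) → ℝ) : (Fin k → ℤ) → ℝ := L.foldr pdiff G

/-- No differences. [folklore] -/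
@[simp] theorem ldiff_nil {k : ℕ} (G : (Fin k → ℤ) → ℝ) : ldiff [] G = G := rfl

/-- `ldiff` on a cons. [folklore] -/
theorem ldiff_cons {k : ℕ} (i : Fin k) (L : List (Fin k)) (G : (Fin k → ℤ) → ℝ) : ldiff (i :: L) G = pdiff i (ldiff L G) := rfl

/-- `ldiff` of a concatenation is the composition. [folklore] -/
theorem ldiff_append {k : ℕ} (L₁ L₂ : List (Fin k)) (G : (Fin k → ℤ) → ℝ) : ldiff (L₁ ++ L₂) G = ldiff L₁ (ldiff L₂ G) := by
  simp [ldiff, List.foldr_append]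

/-- Repeating one coordinate iterates its difference. [folklore] -/
theorem ldiff_replicate {k : ℕ} (i : Fin k) (α : ℕ) (G : (Fin k → ℤ) → ℝ) : ldiff (List.replicate α i) G = (pdiff i)^[α] G := by
  induction α generalizing G with
  | zero => rfl
  | succ α ih => rw [List.replicate_succ, ldiff_cons, ih, Function.iterate_succ_apply']

/-- A difference in the last coordinate, seen along the last-coordinate section `t ↦ G(u', t)`. [folklore] -/
theorem pdiff_last_snoc {k : ℕ} (G : (Fin (k + 1) → ℤ) → ℝ) (u' : Fin k → ℤ) (t : ℤ) :
    pdiff (Fin.last k) G (Fin.snoc u' t) = fwdDiff (fun t => G (Fin.snoc u' t)) t := by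
  simp only [pdiff, fwdDiff, Fin.snoc_last, Fin.update_snoc_last]

/-- Iterated version. [folklore] -/
theorem iter_pdiff_last_snoc {k : ℕ} (G : (Fin (k + 1) → ℤ) → ℝ) (α : ℕ) (u' : Fin k → ℤ) (t : ℤ) :
    ((pdiff (Fin.last k))^[α] G) (Fin.snoc u' t) = (fwdDiff^[α] (fun t => G (Fin.snoc u' t))) t := by
  induction α generalizing G t with
  | zero => rfl
  | succ α ih =>
      rw [Function.iterate_succ_apply', Function.iterate_succ_apply', pdiff_last_snoc]
      simp only [fwdDiff, ih]

/-- A difference in an earlier coordinate commutes with freezing the last one. [folklore] -/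
theorem pdiff_castSucc_snoc {k : ℕ} (i : Fin k) (H : (Fin (k + 1) → ℤ) → ℝ) (u' : Fin k → ℤ) (t : ℤ) :
    pdiff i.castSucc H (Fin.snoc u' t) = pdiff i (fun v => H (Fin.snoc v t)) u' := by
  simp only [pdiff, Fin.snoc_castSucc, ← Fin.snoc_update]

/-- Lists of earlier coordinates commute with freezing the last one. [folklore] -/
theorem ldiff_map_castSucc_snoc {k : ℕ} (L : List (Fin k)) (H : (Fin (k + 1) → ℤ) → ℝ) (u' : Fin k → ℤ) (t : ℤ) :
    ldiff (L.map Fin.castSucc) H (Fin.snoc u' t) = ldiff L (fun v => H (Fin.snoc v t)) u' := by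
  induction L generalizing u' with
  | nil => rfl
  | cons i L ih =>
      rw [List.map_cons, ldiff_cons, ldiff_cons]
      simp only [pdiff, Fin.snoc_castSucc, ← Fin.snoc_update, ih]

/-! ### The total-degree-`s` Newton polynomial and its remainder -/

/-- **The `k`-variable Newton polynomial of total degree `s`** at the origin, evaluated at `u ∈ ℕ^k`
(recursively in the last variable: `Σ_{α≤s} C(u_k,α) · Tay^{(k-1)}_{s-α}[(Δ_k^α G)(·,0)](u')`).
[cite: BrydgesSlade2015RGII, Lemma 3.3.3 (display (e:IH): g_z = Σ_{|β|≤s} C(y,β) D^β g_{(0,z_p)} + Ẽ, iterated)] -/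
def taylorN : (k : ℕ) → (s : ℕ) → ((Fin k → ℤ) → ℝ) → (Fin k → ℕ) → ℝ
  | 0, _, G, _ => G Fin.elim0
  | k + 1, s, G, u => ∑ α ∈ range (s + 1), ((u (Fin.last k)).choose α : ℝ) *
      taylorN k (s - α) (fun v => ((pdiff (Fin.last k))^[α] G) (Fin.snoc v 0)) (Fin.init u)

/-- Vandermonde in the form `Σ_{α≤s} C(a,α)C(b,s+1-α) + C(a,s+1) = C(a+b,s+1)`. [folklore] -/
theorem vandermonde_split (a b s : ℕ) :
    ∑ α ∈ range (s + 1), (a.choose α : ℝ) * (b.choose (s + 1 - α)) + a.choose (s + 1) = ((a + b).choose (s + 1) : ℝ) := by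
  have h := Nat.add_choose_eq a b (s + 1)
  rw [Finset.Nat.sum_antidiagonal_eq_sum_range_succ (fun i j => a.choose i * b.choose j) (s + 1)] at h
  have h' : (((a + b).choose (s + 1) : ℕ) : ℝ) = ∑ k ∈ range (s + 1 + 1), ((a.choose k : ℝ) * (b.choose (s + 1 - k))) := by
    exact_mod_cast h
  conv_rhs => rw [h', Finset.sum_range_succ]
  simp

/-- **[BS-rg-loc] Lemma 3.3.3 on `ℕ^k` (total degree `s`)**: if all `(s+1)`-fold partial differences
of `G` are bounded by `M` on the box `[0,B]`, then `|G(u) - Tay_s G(u)| ≤ M·C(|u|₁, s+1)` for `u ≤ B`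
("The proof is by induction on `p` (with `s` held fixed) … apply the case `p-1` to `g` with the
coordinate `z_p` regarded as a parameter … `|Ẽ| ≤ M_g C(|y|₁, s+1)`" and Vandermonde).
[cite: BrydgesSlade2015RGII, Lemma 3.3.3 (displays (e:Tayrem), (e:IH) and the induction step)] -/
theorem abs_sub_taylorN_le : ∀ (k s : ℕ) (G : (Fin k → ℤ) → ℝ) (B : Fin k → ℕ) (Mb : ℝ),
    (∀ (L : List (Fin k)) (u : Fin k → ℤ), L.length = s + 1 → (∀ i, 0 ≤ u i ∧ u i ≤ B i) → |ldiff L G u| ≤ Mb) →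
    ∀ u : Fin k → ℕ, (∀ i, u i ≤ B i) → |G (fun i => (u i : ℤ)) - taylorN k s G u| ≤ Mb * ((∑ i, u i).choose (s + 1) : ℝ)
  | 0, s, G, B, Mb, _, u, _ => by
      have : (fun i : Fin 0 => (u i : ℤ)) = Fin.elim0 := funext fun i => i.elim0
      simp [taylorN, this]
  | k + 1, s, G, B, Mb, hyp, u, hu => by
      set u' : Fin k → ℕ := Fin.init u with hu'
      set m := u (Fin.last k) with hm
      -- the last-variable section at `u'`
      set sec : ℤ → ℝ := fun t => G (Fin.snoc (fun i => (u' i : ℤ)) t) with hsec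
      have hpt : (fun i : Fin (k + 1) => (u i : ℤ)) = Fin.snoc (fun i => (u' i : ℤ)) (m : ℤ) := by
        funext i
        refine Fin.lastCases ?_ (fun j => ?_) i
        · simp [hm]
        · simp [hu', Fin.init]
      -- decomposition of the error
      have hdecomp : G (fun i => (u i : ℤ)) - taylorN (k + 1) s G u =
          taylorRemAt s 0 m sec +
            ∑ α ∈ range (s + 1), (m.choose α : ℝ) *
              ((fun v : Fin k → ℤ => ((pdiff (Fin.last k))^[α] G) (Fin.snoc v 0)) (fun i => (u' i : ℤ)) -
                taylorN k (s - α) (fun v => ((pdiff (Fin.last k))^[α] G) (Fin.snoc v 0)) u') := by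
        simp only [taylorN, taylorRemAt, ← hm, ← hu', mul_sub, Finset.sum_sub_distrib]
        rw [hpt]
        have e1 : sec (0 + (m : ℤ)) = G (Fin.snoc (fun i => (u' i : ℤ)) (m : ℤ)) := by simp [hsec]
        have e2 : ∀ α, (fwdDiff^[α] sec) 0 = ((pdiff (Fin.last k))^[α] G) (Fin.snoc (fun i => (u' i : ℤ)) 0) := by
          intro α; rw [iter_pdiff_last_snoc]
        rw [e1]
        simp only [e2]
        ring
      rw [hdecomp]
      -- bound the 1-D remainder
      have h1 : |taylorRemAt s 0 m sec| ≤ (m.choose (s + 1) : ℝ) * Mb := by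
        refine abs_taylorRemAt_le s 0 m sec Mb fun x hx0 hxm => ?_
        rw [hsec, ← iter_pdiff_last_snoc, ← ldiff_replicate]
        refine hyp _ _ (by simp) fun i => ?_
        refine Fin.lastCases ?_ (fun j => ?_) i
        · simp only [Fin.snoc_last]
          have hB : (m : ℤ) ≤ B (Fin.last k) := by rw [hm]; exact_mod_cast hu (Fin.last k)
          exact ⟨hx0, by linarith⟩
        · simp only [Fin.snoc_castSucc]
          exact ⟨by positivity, by have := hu j.castSucc; rw [hu']; exact_mod_cast this⟩
      -- bound the inner remainders by induction
      have h2 : ∀ α ∈ range (s + 1), |(m.choose α : ℝ) *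
          ((fun v : Fin k → ℤ => ((pdiff (Fin.last k))^[α] G) (Fin.snoc v 0)) (fun i => (u' i : ℤ)) -
            taylorN k (s - α) (fun v => ((pdiff (Fin.last k))^[α] G) (Fin.snoc v 0)) u')| ≤
          (m.choose α : ℝ) * (Mb * ((∑ i, u' i).choose (s - α + 1) : ℝ)) := by
        intro α hα
        rw [Finset.mem_range] at hα
        rw [abs_mul, Nat.abs_cast]
        refine mul_le_mul_of_nonneg_left ?_ (by positivity)
        refine abs_sub_taylorN_le k (s - α) (fun v => ((pdiff (Fin.last k))^[α] G) (Fin.snoc v 0)) (Fin.init B) Mb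
          (fun L v hL hv => ?_) u' fun i => by rw [hu']; exact hu i.castSucc
        -- inherited hypothesis
        simp only [← ldiff_replicate]
        rw [← ldiff_map_castSucc_snoc, ← ldiff_append]
        refine hyp _ _ (by simp [hL]; omega) fun i => ?_
        refine Fin.lastCases ?_ (fun j => ?_) i
        · simp only [Fin.snoc_last]; exact ⟨le_rfl, by positivity⟩
        · simp only [Fin.snoc_castSucc]; exact hv j
      calc |taylorRemAt s 0 m sec + ∑ α ∈ range (s + 1), (m.choose α : ℝ) * _|
          ≤ |taylorRemAt s 0 m sec| + ∑ α ∈ range (s + 1), |(m.choose α : ℝ) * _| :=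
            (abs_add_le _ _).trans (add_le_add le_rfl (Finset.abs_sum_le_sum_abs _ _))
        _ ≤ (m.choose (s + 1) : ℝ) * Mb + ∑ α ∈ range (s + 1), (m.choose α : ℝ) * (Mb * ((∑ i, u' i).choose (s - α + 1) : ℝ)) :=
            add_le_add h1 (Finset.sum_le_sum h2)
        _ = Mb * (∑ α ∈ range (s + 1), (m.choose α : ℝ) * ((∑ i, u' i).choose (s + 1 - α)) + m.choose (s + 1)) := by
            rw [mul_add, Finset.mul_sum, add_comm]
            congr 1
            · refine Finset.sum_congr rfl fun α hα => ?_
              rw [Finset.mem_range] at hα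
              rw [show s - α + 1 = s + 1 - α by omega]
              ring
            · ring
        _ = Mb * (((m + ∑ i, u' i).choose (s + 1) : ℕ) : ℝ) := by rw [vandermonde_split]
        _ = Mb * ((∑ i, u i).choose (s + 1) : ℝ) := by
            congr 2
            rw [Fin.sum_univ_castSucc, add_comm]
            simp [hu', hm, Fin.init]

end Bump

end LongRangePhi4

end Literature.Barriers.CriticalPhenomena
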